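import Summits.Ventures.PercRepro.SixFourResidueTwoPointsA

/-!
# PercRepro — C-025 at `(6,4)`: «plane + two points» solids at `t = 4`, part B (p2, gen 8 — Theorem 21.6): the
summand `f(B) = 2·w_∞(B) − (6/5)·[B ∉ DF₄]`, the two points `{a, a′} = G ∖ P₀` (`TwoOff`), the set identities, and the
regrouped sum `J₄ ≥ Σ_{B″ ∈ R₃(τ)} c(B″) − (12/5)·Σ_{B″} dem(B″)` (`J_four_ge_shares`).
-/

namespace PercRepro.SixFour

open Finset ThmH

variable {α : Type*} [DecidableEq α] {M : Matroid α} [M.Finite] {G : Finset α}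

/-! ## The regrouped sum: `J₄ ≥ Σ_{B″ ∈ R₃(τ)} c(B″) − (12/5)·#{B″ : r(τ ∖ B″) = 3}` -/

/-- The summand of `J₄`: `f(B) = 2·w_∞(B) − (6/5)·[B ∉ DF₄]`. -/
noncomputable def jterm (M : Matroid α) [M.Finite] (G B : Finset α) : ℚ :=
  2 * wInf M B - 6 / 5 * (if M.eRk ((G \ B : Finset α) : Set α) + 1 ≤ (4 : ℕ∞) then 0 else 1)

/-- `J₄ = Σ_{B ∈ R₄} f(B)`. -/
theorem J_four_eq_sum_jterm : J M G 4 = ∑ B ∈ R4 M G, jterm M G B := by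
  have hind : ∑ B ∈ R4 M G, (if M.eRk ((G \ B : Finset α) : Set α) + 1 ≤ (4 : ℕ∞) then (0 : ℚ) else 1) =
      (N4 M G : ℚ) - (DF M G 4 : ℚ) := by
    unfold N4 DF
    rw [← Finset.card_filter_add_card_filter_not (s := R4 M G)
      (fun B : Finset α => M.eRk ((G \ B : Finset α) : Set α) + 1 ≤ (4 : ℕ∞))]
    rw [Finset.sum_ite, Finset.sum_const_zero, Finset.sum_const, zero_add, nsmul_eq_mul, mul_one]
    push_cast
    ring
  unfold J jterm
  rw [Finset.sum_sub_distrib, ← Finset.mul_sum]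
  have h3 : ∑ x ∈ R4 M G, 2 * wInf M x = 2 * ∑ x ∈ R4 M G, wInf M x := (Finset.mul_sum _ _ _).symm
  have h2 : ∑ x ∈ R4 M G, 6 / 5 * (if M.eRk ((G \ x : Finset α) : Set α) + 1 ≤ (4 : ℕ∞) then (0 : ℚ) else 1) =
      6 / 5 * ∑ x ∈ R4 M G, (if M.eRk ((G \ x : Finset α) : Set α) + 1 ≤ (4 : ℕ∞) then (0 : ℚ) else 1) :=
    (Finset.mul_sum _ _ _).symm
  rw [h2, h3, hind]
  push_cast
  ring

/-- `f ≥ −6/5 + 2·w`, and `f(B) = 2·w(B)` when `B ∈ DF₄`. -/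
theorem jterm_nonneg_of_DF {B : Finset α} (h : M.eRk ((G \ B : Finset α) : Set α) + 1 ≤ (4 : ℕ∞)) :
    0 ≤ jterm M G B := by
  unfold jterm
  rw [if_pos h]
  have := wInf_pos (M := M) B
  linarith

section PlaneTwo

variable {P₀ : Finset α} {a a' : α}

/-- The two points off the plane: `G ∖ P₀ = {a, a′}`. -/
structure TwoOff (M : Matroid α) [M.Finite] (G P₀ : Finset α) (a a' : α) : Prop where
  /-- `a ∈ G` -/
  aG : a ∈ G
  /-- `a′ ∈ G` -/
  a'G : a' ∈ G
  /-- `a ∉ P₀` -/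
  aP : a ∉ P₀
  /-- `a′ ∉ P₀` -/
  a'P : a' ∉ P₀
  /-- `a ≠ a′` -/
  ne : a ≠ a'
  /-- every point of `G` off `P₀` is `a` or `a′` -/
  cover : ∀ z ∈ G, z ∉ P₀ → z = a ∨ z = a'

/-- `G ∖ P₀` has two points ⇒ `TwoOff`. -/
theorem twoOff_of_card (hcard : (P₀ ∩ G).card + 2 = G.card) : ∃ a a' : α, TwoOff M G P₀ a a' := by
  have h2 : (G \ P₀).card = 2 := by
    have := Finset.card_sdiff_add_card_inter G P₀
    rw [Finset.inter_comm] at this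
    omega
  obtain ⟨a, a', hne, hab⟩ := Finset.card_eq_two.1 h2
  have ha : a ∈ G \ P₀ := by rw [hab]; exact Finset.mem_insert_self _ _
  have ha' : a' ∈ G \ P₀ := by rw [hab]; exact Finset.mem_insert_of_mem (Finset.mem_singleton_self _)
  rw [Finset.mem_sdiff] at ha ha'
  refine ⟨a, a', ⟨ha.1, ha'.1, ha.2, ha'.2, hne, fun z hz hzP => ?_⟩⟩
  have : z ∈ G \ P₀ := Finset.mem_sdiff.2 ⟨hz, hzP⟩
  rw [hab, Finset.mem_insert, Finset.mem_singleton] at this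
  exact this

variable (ht : TwoOff M G P₀ a a')
include ht

/-- `G = τ ∪ {a, a′}` with `τ = P₀ ∩ G`. -/
theorem G_eq_insert_insert : G = insert a (insert a' (P₀ ∩ G)) := by
  ext z
  rw [Finset.mem_insert, Finset.mem_insert, Finset.mem_inter]
  constructor
  · intro hz
    by_cases hzP : z ∈ P₀
    · exact Or.inr (Or.inr ⟨hzP, hz⟩)
    · rcases ht.cover z hz hzP with rfl | rfl
      · exact Or.inl rfl
      · exact Or.inr (Or.inl rfl)
  · rintro (rfl | rfl | ⟨-, hz⟩)
    · exact ht.aG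
    · exact ht.a'G
    · exact hz

/-- `G ∖ (B″ ∪ {a}) = (τ ∖ B″) ∪ {a′}` for `B″ ⊆ τ`. -/
theorem sdiff_insert_eq {B : Finset α} (hB : B ⊆ P₀ ∩ G) : G \ insert a B = insert a' ((P₀ ∩ G) \ B) := by
  ext z
  rw [Finset.mem_sdiff, Finset.mem_insert, Finset.mem_insert, Finset.mem_sdiff, Finset.mem_inter]
  constructor
  · rintro ⟨hzG, hz⟩
    push Not at hz
    by_cases hzP : z ∈ P₀
    · exact Or.inr ⟨⟨hzP, hzG⟩, hz.2⟩
    · rcases ht.cover z hzG hzP with rfl | rfl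
      · exact absurd rfl hz.1
      · exact Or.inl rfl
  · rintro (rfl | ⟨⟨hzP, hzG⟩, hzB⟩)
    · refine ⟨ht.a'G, ?_⟩
      push Not
      exact ⟨ht.ne.symm, fun h => ht.a'P (Finset.mem_inter.1 (hB h)).1⟩
    · refine ⟨hzG, ?_⟩
      push Not
      exact ⟨fun h => ht.aP (h ▸ hzP), hzB⟩

/-- `G ∖ (B″ ∪ {a′}) = (τ ∖ B″) ∪ {a}`. -/
theorem sdiff_insert_eq' {B : Finset α} (hB : B ⊆ P₀ ∩ G) : G \ insert a' B = insert a ((P₀ ∩ G) \ B) := by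
  have ht' : TwoOff M G P₀ a' a := ⟨ht.a'G, ht.aG, ht.a'P, ht.aP, ht.ne.symm, fun z hz hzP =>
    (ht.cover z hz hzP).symm⟩
  exact sdiff_insert_eq ht' hB

/-- `G ∖ (B″ ∪ {a, a′}) = τ ∖ B″`. -/
theorem sdiff_insert_insert_eq (B : Finset α) :
    G \ insert a (insert a' B) = (P₀ ∩ G) \ B := by
  ext z
  rw [Finset.mem_sdiff, Finset.mem_insert, Finset.mem_insert, Finset.mem_sdiff, Finset.mem_inter]
  constructor
  · rintro ⟨hzG, hz⟩
    push Not at hz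
    by_cases hzP : z ∈ P₀
    · exact ⟨⟨hzP, hzG⟩, hz.2.2⟩
    · rcases ht.cover z hzG hzP with rfl | rfl
      · exact absurd rfl hz.1
      · exact absurd rfl hz.2.1
  · rintro ⟨⟨hzP, hzG⟩, hzB⟩
    refine ⟨hzG, ?_⟩
    push Not
    exact ⟨fun h => ht.aP (h ▸ hzP), fun h => ht.a'P (h ▸ hzP), hzB⟩

variable (hG : G ⊆ gr M) (hr : M.eRk (G : Set α) = 4) (hP₀ : P₀ ∈ planes M)
include hG hP₀

/-- `B″ ∪ {a} ∈ R₄(G)` for `B″ ∈ R₃(τ)`. -/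
theorem insert_a_mem_R4 {B : Finset α} (hB : B ∈ R3 M (P₀ ∩ G)) : insert a B ∈ R4 M G := by
  obtain ⟨hBτ, hB3⟩ := mem_R3.1 hB
  rw [mem_R4]
  refine ⟨Finset.insert_subset ht.aG (hBτ.trans Finset.inter_subset_right), ?_⟩
  rw [eRk_insert_of_notMem_plane hP₀ (hBτ.trans Finset.inter_subset_left) (hG ht.aG) ht.aP, hB3]
  rfl

/-- `B″ ∪ {a′} ∈ R₄(G)`. -/
theorem insert_a'_mem_R4 {B : Finset α} (hB : B ∈ R3 M (P₀ ∩ G)) : insert a' B ∈ R4 M G := by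
  obtain ⟨hBτ, hB3⟩ := mem_R3.1 hB
  rw [mem_R4]
  refine ⟨Finset.insert_subset ht.a'G (hBτ.trans Finset.inter_subset_right), ?_⟩
  rw [eRk_insert_of_notMem_plane hP₀ (hBτ.trans Finset.inter_subset_left) (hG ht.a'G) ht.a'P, hB3]
  rfl

include hr in
/-- `B″ ∪ {a, a′} ∈ R₄(G)`. -/
theorem insert_aa'_mem_R4 {B : Finset α} (hB : B ∈ R3 M (P₀ ∩ G)) : insert a (insert a' B) ∈ R4 M G := by
  have h := insert_a'_mem_R4 ht hG hP₀ hB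
  rw [mem_R4] at h ⊢
  refine ⟨Finset.insert_subset ht.aG h.1, le_antisymm ?_ ?_⟩
  · rw [← hr]
    exact M.eRk_mono (Finset.coe_subset.2 (Finset.insert_subset ht.aG h.1))
  · rw [← h.2]
    exact M.eRk_mono (Finset.coe_subset.2 (Finset.subset_insert _ _))

/-- The demand indicator of `B″`: `1` when `r(τ ∖ B″) = 3` (i.e. `¬ (r(τ ∖ B″) + 2 ≤ 4)`). -/
noncomputable def dem (M : Matroid α) [M.Finite] (τ B : Finset α) : ℚ :=
  if M.eRk ((τ \ B : Finset α) : Set α) + 2 ≤ (4 : ℕ∞) then 0 else 1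

/-- `f(B″ ∪ {a}) ≥ 2/(2 + k) − (6/5)·dem(B″)`. -/
theorem jterm_insert_a_ge {B : Finset α} (hB : B ∈ R3 M (P₀ ∩ G)) :
    2 / (2 + (kcol M B : ℚ)) - 6 / 5 * dem M (P₀ ∩ G) B ≤ jterm M G (insert a B) := by
  obtain ⟨hBτ, -⟩ := mem_R3.1 hB
  have hw := wInf_insert_ge hP₀ (hBτ.trans Finset.inter_subset_left) (x := a) ht.aP
  have h2 : (2 : ℚ) / (2 + (kcol M B : ℚ)) = 2 * (1 / (2 + (kcol M B : ℚ))) := by ring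
  unfold jterm dem
  rw [sdiff_insert_eq ht hBτ, eRk_insert_of_notMem_plane hP₀ (Finset.sdiff_subset.trans Finset.inter_subset_left)
    (hG ht.a'G) ht.a'P, add_assoc, show (1 : ℕ∞) + 1 = 2 by norm_num, h2]
  split_ifs <;> linarith

/-- `f(B″ ∪ {a′}) ≥ 2/(2 + k) − (6/5)·dem(B″)`. -/
theorem jterm_insert_a'_ge {B : Finset α} (hB : B ∈ R3 M (P₀ ∩ G)) :
    2 / (2 + (kcol M B : ℚ)) - 6 / 5 * dem M (P₀ ∩ G) B ≤ jterm M G (insert a' B) := by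
  obtain ⟨hBτ, -⟩ := mem_R3.1 hB
  have hw := wInf_insert_ge hP₀ (hBτ.trans Finset.inter_subset_left) (x := a') ht.a'P
  have h2 : (2 : ℚ) / (2 + (kcol M B : ℚ)) = 2 * (1 / (2 + (kcol M B : ℚ))) := by ring
  unfold jterm dem
  rw [sdiff_insert_eq' ht hBτ, eRk_insert_of_notMem_plane hP₀ (Finset.sdiff_subset.trans Finset.inter_subset_left)
    (hG ht.aG) ht.aP, add_assoc, show (1 : ℕ∞) + 1 = 2 by norm_num, h2]
  split_ifs <;> linarith

include hr in
/-- `f(B″ ∪ {a, a′}) ≥ 2/(1 + k)` (never demanded). -/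
theorem jterm_insert_aa'_ge {B : Finset α} (hB : B ∈ R3 M (P₀ ∩ G)) :
    2 / (1 + (kcol M B : ℚ)) ≤ jterm M G (insert a (insert a' B)) := by
  obtain ⟨hBτ, hB3⟩ := mem_R3.1 hB
  have hw := wInf_insert_insert_ge hG hr hP₀ (hBτ.trans Finset.inter_subset_left) (hBτ.trans Finset.inter_subset_right)
    hB3 ht.aG ht.a'G ht.aP ht.a'P ht.ne
  unfold jterm
  rw [sdiff_insert_insert_eq ht B]
  have h3 : M.eRk (((P₀ ∩ G) \ B : Finset α) : Set α) ≤ 3 := by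
    rw [← (mem_planes.1 hP₀).2.2]
    exact M.eRk_mono (Finset.coe_subset.2 (Finset.sdiff_subset.trans Finset.inter_subset_left))
  rw [if_pos (by calc M.eRk (((P₀ ∩ G) \ B : Finset α) : Set α) + 1 ≤ 3 + 1 := add_le_add_left h3 1
    _ = (4 : ℕ∞) := by norm_num)]
  have h2 : (2 : ℚ) / (1 + (kcol M B : ℚ)) = 2 * (1 / (1 + (kcol M B : ℚ))) := by ring
  rw [h2]
  linarith

omit hG hP₀ in
/-- A subset of `G` avoiding `a` and `a′` lies in `τ`. -/
theorem subset_τ_of_notMem {B : Finset α} (hB : B ⊆ G) (ha : a ∉ B) (ha' : a' ∉ B) : B ⊆ P₀ ∩ G := by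
  intro z hz
  rw [Finset.mem_inter]
  refine ⟨?_, hB hz⟩
  by_contra hzP
  rcases ht.cover z (hB hz) hzP with rfl | rfl
  · exact ha hz
  · exact ha' hz

omit hG hP₀ in
/-- A subset of `τ` avoids `a` and `a′`. -/
theorem notMem_of_subset_τ {B : Finset α} (hB : B ⊆ P₀ ∩ G) : a ∉ B ∧ a' ∉ B :=
  ⟨fun h => ht.aP (Finset.mem_inter.1 (hB h)).1, fun h => ht.a'P (Finset.mem_inter.1 (hB h)).1⟩

omit hG hP₀ ht in
/-- `insert x` is injective on the subsets of `τ` for `x ∉ P₀`. -/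
theorem insert_injOn (x : α) (hx : x ∉ P₀) :
    Set.InjOn (fun B : Finset α => insert x B) (R3 M (P₀ ∩ G) : Set (Finset α)) := by
  intro B₁ h₁ B₂ h₂ heq
  have hx₁ : x ∉ B₁ := fun h => hx (Finset.mem_inter.1 ((mem_R3.1 h₁).1 h)).1
  have hx₂ : x ∉ B₂ := fun h => hx (Finset.mem_inter.1 ((mem_R3.1 h₂).1 h)).1
  simp only at heq
  rw [← Finset.erase_insert hx₁, ← Finset.erase_insert hx₂, heq]

omit hG hP₀ in
/-- `B ↦ B ∪ {a, a′}` is injective on the subsets of `τ`. -/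
theorem insert_insert_injOn :
    Set.InjOn (fun B : Finset α => insert a (insert a' B)) (R3 M (P₀ ∩ G) : Set (Finset α)) := by
  intro B₁ h₁ B₂ h₂ heq
  simp only at heq
  have key : ∀ B : Finset α, B ∈ R3 M (P₀ ∩ G) → ((insert a (insert a' B)).erase a).erase a' = B := by
    intro B hB
    have h' := notMem_of_subset_τ ht (mem_R3.1 hB).1
    rw [Finset.erase_insert (by rw [Finset.mem_insert]; push Not; exact ⟨ht.ne, h'.1⟩), Finset.erase_insert h'.2]
  calc B₁ = ((insert a (insert a' B₁)).erase a).erase a' := (key B₁ h₁).symm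
    _ = ((insert a (insert a' B₂)).erase a).erase a' := by rw [heq]
    _ = B₂ := key B₂ h₂

omit [DecidableEq α] hG hP₀ ht in
/-- `r(X) + 1 = 4` gives `r(X) = 3`. -/
theorem eRk_eq_three_of_add_one {X : Finset α} (h : M.eRk (X : Set α) + 1 = 4) : M.eRk (X : Set α) = 3 := by
  obtain ⟨n, hn, -⟩ := eRk_eq_nat M X
  rw [hn] at h ⊢
  have : n + 1 = 4 := by exact_mod_cast h
  exact_mod_cast (show n = 3 by omega)

include hr in
/-- **The regrouped sum**: `Σ_{B″ ∈ R₃(τ)} c(B″) − (12/5)·Σ_{B″} dem(B″) ≤ J₄(G)`. -/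
theorem J_four_ge_shares :
    ∑ B ∈ R3 M (P₀ ∩ G), shareC M B - 12 / 5 * ∑ B ∈ R3 M (P₀ ∩ G), dem M (P₀ ∩ G) B ≤ J M G 4 := by
  set τ := P₀ ∩ G with hτ
  set S₁ := (R3 M τ).image (fun B : Finset α => insert a B) with hS₁
  set S₂ := (R3 M τ).image (fun B : Finset α => insert a' B) with hS₂
  set S₃ := (R3 M τ).image (fun B : Finset α => insert a (insert a' B)) with hS₃
  -- the images lie in `R₄(G)`
  have hsub : S₁ ∪ S₂ ∪ S₃ ⊆ R4 M G := by
    intro B hB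
    rw [Finset.mem_union, Finset.mem_union, hS₁, hS₂, hS₃, Finset.mem_image, Finset.mem_image, Finset.mem_image] at hB
    rcases hB with (⟨B'', h, rfl⟩ | ⟨B'', h, rfl⟩) | ⟨B'', h, rfl⟩
    · exact insert_a_mem_R4 ht hG hP₀ h
    · exact insert_a'_mem_R4 ht hG hP₀ h
    · exact insert_aa'_mem_R4 ht hG hr hP₀ h
  -- disjointness
  have hmem₁ : ∀ B ∈ S₁, a' ∉ B := by
    intro B hB
    rw [hS₁, Finset.mem_image] at hB
    obtain ⟨B'', h, rfl⟩ := hB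
    rw [Finset.mem_insert]
    push Not
    exact ⟨ht.ne.symm, (notMem_of_subset_τ ht (mem_R3.1 h).1).2⟩
  have hmem₂ : ∀ B ∈ S₂, a ∉ B := by
    intro B hB
    rw [hS₂, Finset.mem_image] at hB
    obtain ⟨B'', h, rfl⟩ := hB
    rw [Finset.mem_insert]
    push Not
    exact ⟨ht.ne, (notMem_of_subset_τ ht (mem_R3.1 h).1).1⟩
  have hmem₃ : ∀ B ∈ S₃, a ∈ B ∧ a' ∈ B := by
    intro B hB
    rw [hS₃, Finset.mem_image] at hB
    obtain ⟨B'', -, rfl⟩ := hB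
    exact ⟨Finset.mem_insert_self _ _, Finset.mem_insert_of_mem (Finset.mem_insert_self _ _)⟩
  have hd₁₂ : Disjoint S₁ S₂ := by
    rw [Finset.disjoint_left]
    intro B h₁ h₂
    rw [hS₂, Finset.mem_image] at h₂
    obtain ⟨B'', -, rfl⟩ := h₂
    exact hmem₁ _ h₁ (Finset.mem_insert_self _ _)
  have hd₁₂₃ : Disjoint (S₁ ∪ S₂) S₃ := by
    rw [Finset.disjoint_left]
    intro B h₁₂ h₃
    rw [Finset.mem_union] at h₁₂
    rcases h₁₂ with h | h
    · exact hmem₁ _ h (hmem₃ _ h₃).2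
    · exact hmem₂ _ h (hmem₃ _ h₃).1
  -- the remaining rank-`4` subsets have nonnegative summand
  have hnn : ∀ B ∈ R4 M G, B ∉ S₁ ∪ S₂ ∪ S₃ → 0 ≤ jterm M G B := by
    intro B hB hnot
    obtain ⟨hBG, hB4⟩ := mem_R4.1 hB
    rw [Finset.mem_union, Finset.mem_union] at hnot
    push Not at hnot
    by_cases haB : a ∈ B <;> by_cases ha'B : a' ∈ B
    · -- both: `B = B″ ∪ {a, a′}`; `r(B″) = 3` is excluded, so `r(G ∖ B) = r(τ ∖ B″) ≤ 3`
      set B'' := (B.erase a).erase a' with hB''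
      have hB''τ : B'' ⊆ τ := subset_τ_of_notMem ht ((Finset.erase_subset _ _).trans ((Finset.erase_subset _ _).trans hBG))
        (fun h => (Finset.mem_erase.1 (Finset.mem_erase.1 h).2).1 rfl) (fun h => (Finset.mem_erase.1 h).1 rfl)
      have hBeq : B = insert a (insert a' B'') := by
        rw [hB'', Finset.insert_erase (Finset.mem_erase.2 ⟨ht.ne.symm, ha'B⟩), Finset.insert_erase haB]
      apply jterm_nonneg_of_DF
      rw [hBeq, sdiff_insert_insert_eq ht B'']
      have h3 : M.eRk ((τ \ B'' : Finset α) : Set α) ≤ 3 := by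
        rw [← (mem_planes.1 hP₀).2.2]
        exact M.eRk_mono (Finset.coe_subset.2 (Finset.sdiff_subset.trans Finset.inter_subset_left))
      calc M.eRk ((τ \ B'' : Finset α) : Set α) + 1 ≤ 3 + 1 := add_le_add_left h3 1
        _ = (4 : ℕ∞) := by norm_num
    · -- `a ∈ B`, `a′ ∉ B`: `B = B″ ∪ {a}` with `B″ ∈ R₃(τ)` — in `S₁`, excluded
      exfalso
      apply hnot.1.1
      set B'' := B.erase a with hB''
      have hB''τ : B'' ⊆ τ := subset_τ_of_notMem ht ((Finset.erase_subset _ _).trans hBG)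
        (fun h => (Finset.mem_erase.1 h).1 rfl) (fun h => ha'B (Finset.mem_erase.1 h).2)
      have hBeq : B = insert a B'' := by rw [hB'', Finset.insert_erase haB]
      have h3 : M.eRk ((B'' : Finset α) : Set α) = 3 := by
        apply eRk_eq_three_of_add_one
        rw [← eRk_insert_of_notMem_plane hP₀ (hB''τ.trans Finset.inter_subset_left) (hG ht.aG) ht.aP, ← hBeq, hB4]
      rw [hS₁, Finset.mem_image]
      exact ⟨B'', mem_R3.2 ⟨hB''τ, h3⟩, hBeq.symm⟩
    · -- `a′ ∈ B`, `a ∉ B`: in `S₂`, excluded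
      exfalso
      apply hnot.1.2
      set B'' := B.erase a' with hB''
      have hB''τ : B'' ⊆ τ := subset_τ_of_notMem ht ((Finset.erase_subset _ _).trans hBG)
        (fun h => haB (Finset.mem_erase.1 h).2) (fun h => (Finset.mem_erase.1 h).1 rfl)
      have hBeq : B = insert a' B'' := by rw [hB'', Finset.insert_erase ha'B]
      have h3 : M.eRk ((B'' : Finset α) : Set α) = 3 := by
        apply eRk_eq_three_of_add_one
        rw [← eRk_insert_of_notMem_plane hP₀ (hB''τ.trans Finset.inter_subset_left) (hG ht.a'G) ht.a'P, ← hBeq, hB4]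
      rw [hS₂, Finset.mem_image]
      exact ⟨B'', mem_R3.2 ⟨hB''τ, h3⟩, hBeq.symm⟩
    · -- neither: `B ⊆ τ ⊆ P₀` has rank `≤ 3`
      exfalso
      have hBτ := subset_τ_of_notMem ht hBG haB ha'B
      have : M.eRk (B : Set α) ≤ 3 := by
        rw [← (mem_planes.1 hP₀).2.2]
        exact M.eRk_mono (Finset.coe_subset.2 (hBτ.trans Finset.inter_subset_left))
      rw [hB4] at this
      exact absurd this (by decide)
  -- assemble
  have hper : ∀ B ∈ R3 M τ, shareC M B - 12 / 5 * dem M τ B ≤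
      jterm M G (insert a B) + jterm M G (insert a' B) + jterm M G (insert a (insert a' B)) := by
    intro B hB
    have h1 := jterm_insert_a_ge ht hG hP₀ hB
    have h2 := jterm_insert_a'_ge ht hG hP₀ hB
    have h3 := jterm_insert_aa'_ge ht hG hr hP₀ hB
    unfold shareC
    have e : (4 : ℚ) / (2 + (kcol M B : ℚ)) = 2 / (2 + (kcol M B : ℚ)) + 2 / (2 + (kcol M B : ℚ)) := by ring
    rw [e]
    linarith
  calc ∑ B ∈ R3 M τ, shareC M B - 12 / 5 * ∑ B ∈ R3 M τ, dem M τ B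
      = ∑ B ∈ R3 M τ, (shareC M B - 12 / 5 * dem M τ B) := by
        rw [Finset.sum_sub_distrib, Finset.mul_sum]
    _ ≤ ∑ B ∈ R3 M τ, (jterm M G (insert a B) + jterm M G (insert a' B) + jterm M G (insert a (insert a' B))) :=
        Finset.sum_le_sum hper
    _ = ∑ B ∈ S₁, jterm M G B + ∑ B ∈ S₂, jterm M G B + ∑ B ∈ S₃, jterm M G B := by
        rw [Finset.sum_add_distrib, Finset.sum_add_distrib, hS₁, hS₂, hS₃,
          Finset.sum_image (insert_injOn a ht.aP), Finset.sum_image (insert_injOn a' ht.a'P),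
          Finset.sum_image (insert_insert_injOn ht)]
    _ = ∑ B ∈ S₁ ∪ S₂ ∪ S₃, jterm M G B := by
        rw [Finset.sum_union hd₁₂₃, Finset.sum_union hd₁₂]
    _ ≤ ∑ B ∈ R4 M G, jterm M G B := Finset.sum_le_sum_of_subset_of_nonneg hsub hnn
    _ = J M G 4 := (J_four_eq_sum_jterm).symm

end PlaneTwo

end PercRepro.SixFour
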